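import Literature.NumberTheory.Automorphic.MatrixCoefficients
import Mathlib.RepresentationTheory.Intertwining
import Mathlib.LinearAlgebra.FiniteDimensional.Lemmas
import HarnessLib

/-!
# Crux `H413`, pay-down of the K1w letter — file 2/4: eigen-line functionals on a two-dimensional Jacquet module

Cell hodgecm-mathlib (D-0151), FLOOR 0, crux item H413 = stmt-HodgeConjecture-24833; K1 sub-line `Lines/F0_P2GR91NJacquetK1.lean` (v3a),
letter ★ `Rogawski1990.cmPrincipalSeries_isConstituentOf_weylConj`.  HC_CM is proved only modulo the 2 remaining named inputs (hLiu418,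
h413) until rung 0 closes; nothing here proves HC_CM.

THIS FILE (pure linear algebra of a COMMUTATIVE group `M` acting on a complex vector space `X`; theorems only): the two facts about the
Jacquet module `X = r_P i(χ)` of a rank-one principal series that Casselman's bookkeeping [Casselman1995, §7.1, L. 7.1.1] uses, stated for
an abstract `M`-representation `r` on `X` with an `α`-eigen-LINE `ℓ` and quotient character `β ≠ α` (`r(m)x − β(m)x ∈ ℓ`):
* §1 `exists_intertwiningMap_character_of_line` — a NON-ZERO `M`-map `X → ℂ_α` (the spectral projection onto `ℓ` along `r(m₀)`,
  `α(m₀) ≠ β(m₀)`), i.e. `Hom_M(X, ℂ_α) ≠ 0`;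
* §2 `intertwiningMap_character_eq_smul` — when `dim X = 2`, `Hom_M(X, ℂ_β)` is a LINE (every `M`-map `X → ℂ_β` kills `ℓ`).
By Frobenius reciprocity these become `Hom_G(i(χ'), i(χ)) ≠ 0` and `End_G(i(χ)) = ℂ` (file 3/4).

## References
* [Casselman1995] W. Casselman, *Introduction to the theory of admissible representations of `p`-adic reductive groups* (1995), §7.1 L. 7.1.1.
* [BernsteinZelevinsky1977] I. N. Bernstein, A. V. Zelevinsky, Ann. Sci. ÉNS 10 (1977), §2.12–2.13.
-/

set_option autoImplicit false
-- the mandated namespace has the single-problem summit's repeated segment (`HodgeConjecture.HodgeConjecture`)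
set_option linter.dupNamespace false

noncomputable section

namespace Summit.HodgeConjecture.HodgeConjecture.Cruxes.H413.F0P2pEigenlineFunctionals

/-! ## §1 A non-zero `M`-map onto the eigen-line character -/

section Line

variable {M : Type*} [Group M] {X : Type*} [AddCommGroup X] [Module ℂ X]

/-- Two distinct characters differ somewhere (as complex numbers). [folklore] -/
theorem exists_apply_ne_of_ne {α β : M →* ℂˣ} (hne : α ≠ β) : ∃ m : M, ((α m : ℂˣ) : ℂ) ≠ ((β m : ℂˣ) : ℂ) := by
  by_contra h
  push Not at h
  exact hne (MonoidHom.ext fun m => Units.ext (h m))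

/-- **Projection onto an eigen-line.**  Let a COMMUTATIVE group `M` act on `X`, let `ℓ ≤ X` be a LINE on which `M` acts by `α`, and
suppose `M` acts by `β ≠ α` on `X ⁄ ℓ` (`r(m)x − β(m)x ∈ ℓ`).  Then there is a NON-ZERO `M`-map `X → ℂ_α`: with `α(m₀) ≠ β(m₀)`, the operator
`(α(m₀) − β(m₀))⁻¹ (r(m₀) − β(m₀))` is an `M`-equivariant projection of `X` onto `ℓ ≅ ℂ_α`. [cite: Casselman1995, §7.1 L. 7.1.1] -/
theorem exists_intertwiningMap_character_of_line (hcomm : ∀ m m' : M, m * m' = m' * m) (r : Representation ℂ M X)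
    (α β : M →* ℂˣ) (hne : α ≠ β) (ℓ : Submodule ℂ X) (hℓ1 : Module.finrank ℂ ↥ℓ = 1)
    (hℓ : ∀ m, ∀ x ∈ ℓ, r m x = ((α m : ℂˣ) : ℂ) • x) (hq : ∀ m x, r m x - ((β m : ℂˣ) : ℂ) • x ∈ ℓ) :
    ∃ φ : r.IntertwiningMap ((Representation.trivial ℂ M ℂ).twist α), φ ≠ 0 := by
  obtain ⟨m₀, hm₀⟩ := exists_apply_ne_of_ne hne
  haveI : Module.Finite ℂ ↥ℓ := Module.finite_of_finrank_eq_succ hℓ1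
  -- the coordinate `ℓ ≃ ℂ`
  let e : ↥ℓ ≃ₗ[ℂ] ℂ := LinearEquiv.ofFinrankEq _ _ (by rw [hℓ1, Module.finrank_self])
  -- the projection `P = c⁻¹ (r m₀ - β m₀)` into `ℓ`
  set c : ℂ := ((α m₀ : ℂˣ) : ℂ) - ((β m₀ : ℂˣ) : ℂ) with hc
  have hc0 : c ≠ 0 := sub_ne_zero.2 hm₀
  let P₀ : X →ₗ[ℂ] X := c⁻¹ • (r m₀ - ((β m₀ : ℂˣ) : ℂ) • LinearMap.id)
  have hP₀ : ∀ x, P₀ x = c⁻¹ • (r m₀ x - ((β m₀ : ℂˣ) : ℂ) • x) := fun x => rfl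
  have hP₀mem : ∀ x, P₀ x ∈ ℓ := fun x => by rw [hP₀]; exact ℓ.smul_mem _ (hq m₀ x)
  have hP₀id : ∀ x ∈ ℓ, P₀ x = x := fun x hx => by
    rw [hP₀, hℓ m₀ x hx, ← sub_smul, ← hc, smul_smul, inv_mul_cancel₀ hc0, one_smul]
  have hP₀comm : ∀ m x, P₀ (r m x) = r m (P₀ x) := fun m x => by
    rw [hP₀, hP₀, map_smul, map_sub, map_smul, ← Module.End.mul_apply, ← map_mul, hcomm, map_mul, Module.End.mul_apply]
  let P : X →ₗ[ℂ] ↥ℓ := LinearMap.codRestrict ℓ P₀ hP₀mem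
  -- the functional
  let φ₀ : X →ₗ[ℂ] ℂ := (e : ↥ℓ →ₗ[ℂ] ℂ) ∘ₗ P
  have hφ₀ : ∀ m x, φ₀ (r m x) = ((α m : ℂˣ) : ℂ) * φ₀ x := fun m x => by
    change e (P (r m x)) = ((α m : ℂˣ) : ℂ) * e (P x)
    have h1 : P (r m x) = ((α m : ℂˣ) : ℂ) • P x := by
      apply Subtype.ext
      change P₀ (r m x) = ((α m : ℂˣ) : ℂ) • P₀ x
      rw [hP₀comm, hℓ m _ (hP₀mem x)]
    rw [h1, map_smul, smul_eq_mul]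
  refine ⟨⟨φ₀, fun m => LinearMap.ext fun x => ?_⟩, ?_⟩
  · change φ₀ (r m x) = ((α m : ℂˣ) : ℂ) • ((Representation.trivial ℂ M ℂ) m (φ₀ x))
    rw [Representation.trivial_apply, hφ₀, smul_eq_mul]
  · -- non-zero on a generator of `ℓ`
    haveI : Nontrivial ↥ℓ := Module.nontrivial_of_finrank_eq_succ hℓ1
    obtain ⟨x₀, hx₀⟩ := exists_ne (0 : ↥ℓ)
    intro h0
    have h1 : φ₀ (x₀ : X) = 0 := by
      have := congrArg (fun ψ : r.IntertwiningMap ((Representation.trivial ℂ M ℂ).twist α) => ψ (x₀ : X)) h0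
      simpa using this
    have h2 : P (x₀ : X) = x₀ := Subtype.ext (hP₀id _ x₀.2)
    apply hx₀
    apply e.injective
    rw [map_zero, ← h1]
    change e x₀ = e (P (x₀ : X))
    rw [h2]

end Line

/-! ## §2 `Hom_M(r_P i(χ), ℂ_χ)` is a line -/

section Unique

variable {M : Type*} [Group M] {X : Type*} [AddCommGroup X] [Module ℂ X]

/-- An `M`-map `X → ℂ_β` kills an `α`-eigen-line when `α ≠ β`. [cite: Casselman1995, §7.1 L. 7.1.1] -/
theorem intertwiningMap_character_apply_eq_zero_of_mem (r : Representation ℂ M X) (α β : M →* ℂˣ) (hne : α ≠ β)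
    (ℓ : Submodule ℂ X) (hℓ : ∀ m, ∀ x ∈ ℓ, r m x = ((α m : ℂˣ) : ℂ) • x)
    (ψ : r.IntertwiningMap ((Representation.trivial ℂ M ℂ).twist β)) (x : X) (hx : x ∈ ℓ) : ψ x = 0 := by
  obtain ⟨m₀, hm₀⟩ := exists_apply_ne_of_ne hne
  have h := Representation.IntertwiningMap.isIntertwining _ _ ψ m₀ x
  rw [hℓ m₀ x hx, map_smul] at h
  simp only [Representation.twist_apply, Representation.trivial_apply, smul_eq_mul] at h
  have h' : (((α m₀ : ℂˣ) : ℂ) - ((β m₀ : ℂˣ) : ℂ)) * ψ x = 0 := by rw [sub_mul, h, sub_self]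
  exact (mul_eq_zero.1 h').resolve_left (sub_ne_zero.2 hm₀)

/-- **`Hom_M(X, ℂ_β)` is a line** when `X` is 2-dimensional with an `α`-eigen-line `ℓ`, `α ≠ β`: two `M`-maps `X → ℂ_β` both kill `ℓ`
(§2 above), so they are proportional — the second is a multiple of the first as soon as the first is non-zero.
[cite: Casselman1995, §7.1 L. 7.1.1] -/
theorem intertwiningMap_character_eq_smul (r : Representation ℂ M X) [FiniteDimensional ℂ X] (hX : Module.finrank ℂ X = 2)
    (α β : M →* ℂˣ) (hne : α ≠ β) (ℓ : Submodule ℂ X) (hℓ1 : Module.finrank ℂ ↥ℓ = 1)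
    (hℓ : ∀ m, ∀ x ∈ ℓ, r m x = ((α m : ℂˣ) : ℂ) • x)
    (ψ₁ ψ₂ : r.IntertwiningMap ((Representation.trivial ℂ M ℂ).twist β)) (h₁ : ψ₁ ≠ 0) :
    ∃ c : ℂ, ψ₂ = c • ψ₁ := by
  -- a vector outside the line
  have hℓtop : ℓ ≠ ⊤ := by
    intro h
    have := hℓ1
    rw [h, finrank_top, hX] at this
    exact absurd this (by norm_num)
  obtain ⟨x₁, hx₁⟩ : ∃ x₁ : X, x₁ ∉ ℓ := by
    by_contra h
    push Not at h
    exact hℓtop (eq_top_iff.2 fun x _ => h x)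
  have hx₁0 : x₁ ≠ 0 := fun h => hx₁ (h ▸ ℓ.zero_mem)
  -- `ℓ ⊔ ℂ x₁ = X`
  have hdisj : Disjoint ℓ (ℂ ∙ x₁) := by
    rw [Submodule.disjoint_span_singleton' hx₁0]
    exact hx₁
  have hsup : ℓ ⊔ (ℂ ∙ x₁) = ⊤ := by
    apply Submodule.eq_top_of_finrank_eq
    have h := Submodule.finrank_sup_add_finrank_inf_eq ℓ (ℂ ∙ x₁)
    rw [disjoint_iff.1 hdisj, finrank_bot, add_zero, hℓ1, finrank_span_singleton hx₁0] at h
    rw [h, hX]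
  -- both maps are determined by their value at `x₁`
  have hval : ∀ (ψ : r.IntertwiningMap ((Representation.trivial ℂ M ℂ).twist β)) (x : X),
      ∃ d : ℂ, ψ x = d * ψ x₁ := by
    intro ψ x
    have hx : x ∈ ℓ ⊔ (ℂ ∙ x₁) := by rw [hsup]; trivial
    obtain ⟨y, hy, z, hz, rfl⟩ := Submodule.mem_sup.1 hx
    obtain ⟨d, rfl⟩ := Submodule.mem_span_singleton.1 hz
    refine ⟨d, ?_⟩
    rw [map_add, intertwiningMap_character_apply_eq_zero_of_mem r α β hne ℓ hℓ ψ y hy, zero_add, map_smul, smul_eq_mul]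
  have h₁x : ψ₁ x₁ ≠ 0 := by
    intro h0
    apply h₁
    apply Representation.IntertwiningMap.ext
    apply LinearMap.ext
    intro x
    obtain ⟨d, hd⟩ := hval ψ₁ x
    change ψ₁ x = 0
    rw [hd, h0, mul_zero]
  refine ⟨ψ₂ x₁ / ψ₁ x₁, Representation.IntertwiningMap.ext (LinearMap.ext fun x => ?_)⟩
  obtain ⟨d₂, hd₂⟩ := hval ψ₂ x
  obtain ⟨d₁, hd₁⟩ := hval ψ₁ x
  -- `d₁ = d₂`: both are the `x₁`-coordinate of `x`; recompute from one decomposition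
  have hx : x ∈ ℓ ⊔ (ℂ ∙ x₁) := by rw [hsup]; trivial
  obtain ⟨y, hy, z, hz, rfl⟩ := Submodule.mem_sup.1 hx
  obtain ⟨d, rfl⟩ := Submodule.mem_span_singleton.1 hz
  change ψ₂ (y + d • x₁) = (ψ₂ x₁ / ψ₁ x₁) • ψ₁ (y + d • x₁)
  rw [map_add, map_add, intertwiningMap_character_apply_eq_zero_of_mem r α β hne ℓ hℓ ψ₁ y hy,
    intertwiningMap_character_apply_eq_zero_of_mem r α β hne ℓ hℓ ψ₂ y hy, zero_add, zero_add, map_smul, map_smul,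
    smul_eq_mul, smul_eq_mul, smul_eq_mul]
  field_simp

end Unique

end Summit.HodgeConjecture.HodgeConjecture.Cruxes.H413.F0P2pEigenlineFunctionals

end
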